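import Summits.QuantumFields.BalabanUV.Beta.D1BFx.RestKernelBlockUnit
import Summits.QuantumFields.BalabanUV.Beta.D1BFx.RestNestedMass
import Summits.QuantumFields.BalabanUV.Beta.D1BFx.GhostWordJetLetters
import Literature.MathematicalPhysics.QuantumFieldTheory.Balaban1983to89.Beta.SecondOrderResponse

/-!
# `BalabanUV.Beta.D1BFx.RestTableBlockMass` — road «BF-x» for binder row D1, slot (K), DICT-CHAIN-SPEC §2 (II) rows RK-BLK ∕ RK-SAND: **«RK-TABLE BLOCK MASSES» —
# THE PLAIN MASS OF A PACKED SECOND-ORDER TABLE `vertex2OfK K n S₂ μ y ν y′` (the bi-vertex through a packed resolvent: BOTH fine slots of a pair-stencil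
# family read through `K`'s `ℋ`-columns at the two coarse bonds) IS `≤ 16·C_H²·Zl 4 (a∕2)·Zl 4 (δ∕2) · mT · e^{−min (a∕2) (δ∕2)·n·|y′ − y|₁}`** from a column
# envelope `|colH K n μ y κ′ u| ≤ C_H·e^{−a|u − n•y|₁}` and the pair stencils' OWN plain block letters `Σ'|S₂ κ′ u κ″ u′| ≤ mT·e^{−δ|u′ − u|₁}` — generic
# in `K`, in the pack `S₂` and in the fibre; at the road's N-leg (`C_H = (n⁵)⁻¹·C₄·e^{κ′}`, `a = κ′∕(4n)`, mod `h12 ∧ h126`) every table block is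
# `O(n⁻⁶)·mT·e^{−min (κ′∕8) (δ∕2)|y′ − y|₁}`, so the THREE RK-BLK TADPOLE WORDS at the road's packed tables are `Decay510` at an n-FREE rate with constants
# `½·T_ij·(C_W·n⁻⁶·mT j i)` — `n⁻¹¹` resp. `n⁻¹⁴` × the pair pack's letter per genuine tadpole word

STATUS: [folklore] `ℓ¹` bookkeeping over FILE `RestNestedMass` (`mass_nested_wsum_le`, this gen), `GhostWordJetLetters.Zl_kappa_le` (g18 FILE 3b), leaf-01's `RestLegEnvelopes.abs_NlegRoad_inl_inr_le` («WH-ENV» in fine `ℓ¹` currency), an2's `SecondOrderResponse.vertex2OfK` BY NAME and FILE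
`RestKernelBlockUnit` (this gen); 0 `sorry`; 0 new definitions; 0 notation; 0 cited facts beyond the two named hypotheses `h12 ∕ h126` of the road's read-out
(§2 only).  HONEST: 0 root-level binders discharged (hW ∕ hR-sockets ∕ hSX-socket ∕ D1Tel ∕ D1Rep — 0); (K) NOT closed (the N-side dictionary (A2-N) must
still NAME the pair pack `S₂,N` the N-tables carry and supply its block letters `mT j i(n)`, `δ`; the slot's `hptw` is not here); NOT D1, NOT `BetaPertH`,
NOT continuum, NOT Clay.
HONEST DEPENDENCY (cell records, verbatim): «continuum YM on T⁴ ⇐ BetaPertH ∧ nine spine estimates (0/9 proved); BetaPertH ⇐ (D1) ∧ (D4) ∧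
CAP+tail; G-an2-4 gates asym, D1 and NE2/3/4.»

ABSOLUTE RULE (cell charter, verbatim): «No internally-minted statement may enter as a cited fact. Every hypothesis is either kernel-proved in
this package or a verbatim quotation of a PUBLISHED theorem with page reference. The manuscript(s) under audit are NOT citable for their own
disputed steps — they are the thing under adjudication; programme-internal (2001/route/tribunal) claims are never citable.»

WHY.  FILE `RestKernelBlockUnit` bounds the three tadpole block words by `½·T_ij·mW_ji` with the TABLE block mass letter `Σ'|(W μ 0 ν z)_ji| ≤ mW j i·e^{−κ|z|₁}`
displayed; FILE `RestJetBlockMass` moved the first-jet letters one level down to the stencil pack.  The road's second-order tables are bi-vertices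
`vertex2OfK K n S₂` (OWNER PART 3b: the M-side table of the (S-LIT) junction is `vertex2OfK G₀ (m+1) S₂`; the N-side one is `vertex2OfK (NlegRoad m a) n S₂,N`
once (A2-N) names `S₂,N` — OWNER W-d1p2-g18-3).  This file moves the table letter one level down too: two `ℋ`-column envelopes and the pair pack's own
letter give the table block mass with an EXPONENTIAL GAIN in the coarse separation — the two columns sit `n·|y′ − y|₁` apart and the pair stencil couples
them at rate `δ` (FILE `RestNestedMass`: of the three exponentials, one half of each pays the coarse distance, the other halves pay the two lattice sums).

CONTENT.
* (generic step = FILE `RestNestedMass.mass_nested_wsum_le`: two weight envelopes + the pair pack's letter ⊢ the nested superposition's plain mass with the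
  coarse-distance gain `e^{−min (a∕2) (δ∕2)·|c₂−c₁|₁}`.)
* §1 [our object ∕ folklore, `d + 1 = 4`] `blk_vertex2OfK` (every block of `vertex2OfK K n S₂ μ y ν y′` IS such a nested superposition of the pack's blocks with
  the weights `colH K n μ y`, `colH K n ν y′` — definitional); **`mass_blk_vertex2OfK_le`** (any packed `K` with a column envelope `|colH K n ρ y κ u| ≤ C_H·e^{−a|u−n•y|₁}`).
* §2 [mod `h12 ∧ h126`] **`mass_blk_vertex2OfK_NlegRoad_le`** (the road's N-leg: `C_H = (n⁵)⁻¹·C₄·e^{κ′}`, `a = κ′∕(4n)` by `RestLegEnvelopes.abs_NlegRoad_inl_inr_le`;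
  `(n⁴)⁻¹·Zl 4 (κ′∕(8n)) ≤ (1+16∕κ′)⁴`): block mass `≤ 16·(C₄e^{κ′})²·(1+16∕κ′)⁴·Zl 4 (δ∕2)·n⁻⁶·mT j i·e^{−min (κ′∕8) (δ∕2)·|y′ − y|₁}`; and
  **`exists_decay510_blockWord_inl_packed`**: the three RK-BLK tadpole words at the road's packed tables `vertex2OfK (NlegRoad m a) n S₂` are `Decay510` at the
  n-FREE rate `min (κ′∕8) (δ∕2)` with constants `½·T_ij·(C_W·Zl 4 (δ∕2)·n⁻⁶·mT j i)`, `T` the leg table of `RestKernelBlockUnit.exists_road_block_legs`.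
NOT HERE (honest): which pair pack `S₂,N` the road's N-tables carry and its letters (row (A2-N)); the M-side∕twisted tables; the `Rk` wiring (leaf-01's lane).
Unit `b2b-balaban-beta-d1-formalise-leaf-04` (gen 19), D1 formalisation swarm leaf prover 04, road «BF-x»; INTENT 3 «RK-TABLE BLOCK MASSES» FILE 3b (journal).
-/

noncomputable section

open Finset
open scoped BigOperators
open Literature.MathematicalPhysics.QuantumFieldTheory.Balaban1983to89
open Literature.MathematicalPhysics.QuantumFieldTheory.Balaban1983to89.Beta
open B12Sec2to5 (l1 l1_nonneg Decay510)
open B5Hk163Strip (kappa163 kappa163_pos)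
open B5Hk163Decay (MG163)
open B4TorusKernel (periodConst)
open ExpKernelCalculus (Site MKer Decays Zl Zl_pos Zl_nonneg l1_natSmul)
open OneStepResolventKernel (Fib wsum)
open OneStepKernelFamily (vertexOfK colH)
open SecondOrderResponse (vertex2OfK)
open VectorTailsLoc (fam kfam)
open Summit.QuantumFields.BalabanUV.Beta.D1BFx.PackedKernelSplit (blk)
open Summit.QuantumFields.BalabanUV.Beta.D1BFx.RWeightedLegPack (NlegRoad)
open Summit.QuantumFields.BalabanUV.Beta.D1BFx.FrozenLegTails (nOf MOf hn1)
open Summit.QuantumFields.BalabanUV.Beta.GAN24.DirichletExhaustionDeltaZ (c166Z kappaZ)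
open Summit.QuantumFields.BalabanUV.Beta.D1BFx.RestKernelWords (blockWord)
open Summit.QuantumFields.BalabanUV.Beta.D1BFx.RestLegEnvelopes (abs_NlegRoad_inl_inr_le)
open Summit.QuantumFields.BalabanUV.Beta.D1BFx.GhostWordJetLetters (Zl_kappa_le)
open Summit.QuantumFields.BalabanUV.Beta.D1BFx.RestKernelBlockUnit (exists_road_block_legs decay510_blockWord_inl_of_decays)
open Summit.QuantumFields.BalabanUV.Beta.D1BFx.RestNestedMass (mass_nested_wsum_le)

namespace Summit.QuantumFields.BalabanUV.Beta.D1BFx.RestTableBlockMass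

/-! ## §1 Every block of a packed second-order table is such a nested superposition (`d + 1 = 4`) -/

section Packed

variable (K : MKer 4 (Fib 3)) (n : ℕ)

/-- [our object] **THE BLOCKS OF THE BI-VERTEX** (definitional): `blk (vertex2OfK K n S₂ μ y ν y′) j i =
Σ_{κ′} wsum (colH K n μ y κ′) (u ↦ Σ_{κ″} wsum (colH K n ν y′ κ″) (u′ ↦ blk (S₂ κ′ u κ″ u′) j i))` — both fine slots of the pair pack read through `K`'s
`ℋ`-columns at the two coarse bonds, block by block. -/
theorem blk_vertex2OfK (S₂ : Fin 4 → Site 4 → Fin 4 → Site 4 → MKer 4 (Fib 3)) (μ : Fin 4) (y : Site 4) (ν : Fin 4) (y' : Site 4) (j i : Bool) :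
    blk (vertex2OfK K n S₂ μ y ν y') j i
      = ∑ κ' : Fin 4, wsum (colH K n μ y κ') (fun u => ∑ κ'' : Fin 4, wsum (colH K n ν y' κ'') (fun u' => blk (S₂ κ' u κ'' u') j i)) := by
  funext x z a b
  simp only [blk, SecondOrderResponse.vertex2OfK, OneStepKernelFamily.vertexOfK, OneStepResolventKernel.wsum, Finset.sum_apply]

/-- [folklore] **THE BLOCK MASSES OF A PACKED SECOND-ORDER TABLE** (any packed `K`): a column envelope `|colH K n ρ y κ u| ≤ C_H·e^{−a|u − n•y|₁}`
(`0 < a`, `0 ≤ C_H`) and the pair pack's plain block letters `Σ'|blk (S₂ κ u κ′ u′) j i| ≤ mT j i·e^{−δ|u′−u|₁}` (`0 < δ`) give, for every pair of coarse bonds and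
every block, a summable plain mass of `blk (vertex2OfK K n S₂ μ y ν y′) j i` bounded by
`16·C_H·C_H·mT j i·(Zl 4 (a∕2)·Zl 4 (δ∕2))·e^{−min (a∕2) (δ∕2)·|n•y′ − n•y|₁}`. -/
theorem mass_blk_vertex2OfK_le {S₂ : Fin 4 → Site 4 → Fin 4 → Site 4 → MKer 4 (Fib 3)} {CH a δ : ℝ} {mT : Bool → Bool → ℝ}
    (ha : 0 < a) (hδ : 0 < δ) (hCH : 0 ≤ CH)
    (hcol : ∀ ρ y κ u, |colH K n ρ y κ u| ≤ CH * Real.exp (-a * l1 (u - (n : ℤ) • y)))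
    (hTs : ∀ κ u κ' u' j i, Summable fun p : Site 4 × Site 4 => ∑ g, ∑ f, |blk (S₂ κ u κ' u') j i p.1 p.2 g f|)
    (hTm : ∀ κ u κ' u' j i, ∑' p : Site 4 × Site 4, ∑ g, ∑ f, |blk (S₂ κ u κ' u') j i p.1 p.2 g f| ≤ mT j i * Real.exp (-δ * l1 (u' - u)))
    (μ : Fin 4) (y : Site 4) (ν : Fin 4) (y' : Site 4) (j i : Bool) :
    (Summable fun p : Site 4 × Site 4 => ∑ g, ∑ f, |blk (vertex2OfK K n S₂ μ y ν y') j i p.1 p.2 g f|) ∧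
      ∑' p : Site 4 × Site 4, ∑ g, ∑ f, |blk (vertex2OfK K n S₂ μ y ν y') j i p.1 p.2 g f|
        ≤ 16 * CH * CH * mT j i * (Zl 4 (a / 2) * Zl 4 (δ / 2)) * Real.exp (-(min (a / 2) (δ / 2)) * l1 ((n : ℤ) • y' - (n : ℤ) • y)) := by
  rw [blk_vertex2OfK]
  have h := mass_nested_wsum_le (ι := Fin 4) (w₁ := fun κ => colH K n μ y κ) (w₂ := fun κ => colH K n ν y' κ)
    (P := fun κ u κ' u' => blk (S₂ κ u κ' u') j i) (mT := mT j i) ha hδ hCH hCH (fun κ u => hcol μ y κ u) (fun κ u => hcol ν y' κ u)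
    (fun κ u κ' u' => hTs κ u κ' u' j i) (fun κ u κ' u' => hTm κ u κ' u' j i)
  refine ⟨h.1, h.2.trans (le_of_eq ?_)⟩
  rw [Fintype.card_fin]
  push_cast
  ring

end Packed

/-! ## §2 The road's packed tables `vertex2OfK (NlegRoad m a) n S₂` (mod `h12 ∧ h126`): `O(n⁻⁶)`, exponential in the coarse separation -/

section Road

variable (m : ℕ) {a : ℝ} (ha : 0 < a)
include ha

omit ha in
/-- [folklore] For `n ≥ 1`, `0 ≤ q`, `0 ≤ L`: `min (p∕n) q · (n·L) ≥ min p q · L` (the rate in the coarse variable). -/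
theorem min_rate_coarse {p q L : ℝ} (hq : 0 ≤ q) (hL : 0 ≤ L) :
    min p q * L ≤ min (p / ((m + 1 : ℕ) : ℝ)) q * (((m + 1 : ℕ) : ℝ) * L) := by
  have hn1 : (1 : ℝ) ≤ ((m + 1 : ℕ) : ℝ) := by exact_mod_cast Nat.le_add_left 1 m
  have hn0 : (0 : ℝ) < ((m + 1 : ℕ) : ℝ) := by positivity
  rw [← mul_assoc, min_mul_of_nonneg _ _ hn0.le, div_mul_cancel₀ _ hn0.ne']
  refine mul_le_mul_of_nonneg_right (min_le_min le_rfl ?_) hL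
  nlinarith

omit ha in
/-- [folklore] `|n•y′ − n•y|₁ = n·|y′ − y|₁`. -/
theorem l1_smul_sub (y y' : Site 4) :
    l1 ((((m + 1 : ℕ) : ℤ)) • y' - (((m + 1 : ℕ) : ℤ)) • y) = ((m + 1 : ℕ) : ℝ) * l1 (y' - y) := by
  rw [← smul_sub, l1_natSmul]

/-- [folklore] **THE BLOCK MASSES OF THE ROAD's PACKED SECOND-ORDER TABLES**: modulo [B5, Prop. 1.2] ∧ [B5, (1.126)–(1.127)] BY NAME (the `ℋ_R`-column
envelope `RestLegEnvelopes.abs_NlegRoad_inl_inr_le`: `C_H = (n⁵)⁻¹·C₄·e^{κ′}`, `a = κ′∕(4n)`), for any PACKED pair pack `S₂` with plain block letters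
`mT j i·e^{−δ|u′−u|₁}` (`0 < δ`), every block of `vertex2OfK (NlegRoad m a) n S₂ μ y ν y′` has summable plain mass
`≤ 16·(C₄·e^{κ′})²·(1 + 16∕κ′)⁴·Zl 4 (δ∕2)·(n⁶)⁻¹·mT j i·e^{−min (κ′∕8) (δ∕2)·|y′ − y|₁}` (`C₄ = MG163 4·periodConst (kappa163 4) 3`, `κ′ = kappa163 4∕4`) —
`C_H²·Zl 4 (κ′∕(8n)) = n⁻¹⁰·C₄²e^{2κ′}·Zl ≤ n⁻⁶·C₄²e^{2κ′}·(1 + 16∕κ′)⁴` (`Zl_kappa_le`), and `min (κ′∕(8n)) (δ∕2)·n·|y′−y|₁ ≥ min (κ′∕8) (δ∕2)·|y′−y|₁`. -/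
theorem mass_blk_vertex2OfK_NlegRoad_le (h12 : B5.Prop12Printed (fam nOf hn1 MOf a ha)) (h126 : B5.Kernel126_127Printed (kfam nOf MOf))
    {S₂ : Fin 4 → Site 4 → Fin 4 → Site 4 → MKer 4 (Fib 3)} {δ : ℝ} {mT : Bool → Bool → ℝ} (hδ : 0 < δ)
    (hTs : ∀ κ u κ' u' j i, Summable fun p : Site 4 × Site 4 => ∑ g, ∑ f, |blk (S₂ κ u κ' u') j i p.1 p.2 g f|)
    (hTm : ∀ κ u κ' u' j i, ∑' p : Site 4 × Site 4, ∑ g, ∑ f, |blk (S₂ κ u κ' u') j i p.1 p.2 g f| ≤ mT j i * Real.exp (-δ * l1 (u' - u)))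
    (μ : Fin 4) (y : Site 4) (ν : Fin 4) (y' : Site 4) (j i : Bool) :
    (Summable fun p : Site 4 × Site 4 => ∑ g, ∑ f, |blk (vertex2OfK (NlegRoad m a) (m + 1) S₂ μ y ν y') j i p.1 p.2 g f|) ∧
      ∑' p : Site 4 × Site 4, ∑ g, ∑ f, |blk (vertex2OfK (NlegRoad m a) (m + 1) S₂ μ y ν y') j i p.1 p.2 g f|
        ≤ 16 * ((MG163 4 * periodConst (kappa163 4) 3) * Real.exp (kappa163 4 / 4)) ^ 2 * (1 + 16 / (kappa163 4 / 4)) ^ 4 * Zl 4 (δ / 2)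
          * ((((m + 1 : ℕ) : ℝ)) ^ 6)⁻¹ * mT j i * Real.exp (-(min (kappa163 4 / 4 / 8) (δ / 2)) * l1 (y' - y)) := by
  have hn0 : (0 : ℝ) < ((m + 1 : ℕ) : ℝ) := by exact_mod_cast Nat.succ_pos m
  have hκ : 0 < kappa163 (3 + 1) := kappa163_pos (3 + 1)
  set CH : ℝ := ((((m + 1 : ℕ) : ℝ)) ^ (3 + 2))⁻¹ * (MG163 (3 + 1) * periodConst (kappa163 (3 + 1)) 3) * Real.exp (kappa163 (3 + 1) / (3 + 1))
    with hCH
  set aa : ℝ := kappa163 (3 + 1) / (3 + 1) / (4 * ((m + 1 : ℕ) : ℝ)) with haa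
  have haa0 : 0 < aa := by positivity
  -- the column envelope of the road's N-leg (`colH (NlegRoad m a) n ρ y κ u = NlegRoad m a u (n•y) (inl κ) (inr ρ)`)
  have hcol : ∀ ρ y₀ κ u, |colH (NlegRoad m a) (m + 1) ρ y₀ κ u| ≤ CH * Real.exp (-aa * l1 (u - ((m + 1 : ℕ) : ℤ) • y₀)) :=
    fun ρ y₀ κ u => abs_NlegRoad_inl_inr_le m ha h12 h126 u _ κ ρ
  have hCH0 : 0 ≤ CH := by
    have h := hcol 0 0 0 0
    exact (mul_nonneg_iff_of_pos_right (Real.exp_pos _)).1 ((abs_nonneg _).trans h)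
  have hmT : 0 ≤ mT j i := by
    have h := (tsum_nonneg fun p => Finset.sum_nonneg fun g _ => Finset.sum_nonneg fun f _ => abs_nonneg _).trans (hTm 0 0 0 0 j i)
    have e0 : l1 ((0 : Site 4) - 0) = 0 := by simp [l1]
    rw [e0, mul_zero, Real.exp_zero, mul_one] at h
    exact h
  obtain ⟨hs, hb⟩ := mass_blk_vertex2OfK_le (NlegRoad m a) (m + 1) haa0 hδ hCH0 hcol hTs hTm μ y ν y' j i
  refine ⟨hs, hb.trans ?_⟩
  -- the exponential: `min (aa∕2) (δ∕2)·|n•y′ − n•y|₁ ≥ min (κ′∕8) (δ∕2)·|y′ − y|₁`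
  have hexp : Real.exp (-(min (aa / 2) (δ / 2)) * l1 (((m + 1 : ℕ) : ℤ) • y' - ((m + 1 : ℕ) : ℤ) • y))
      ≤ Real.exp (-(min (kappa163 4 / 4 / 8) (δ / 2)) * l1 (y' - y)) := by
    apply Real.exp_le_exp.2
    have hL := l1_nonneg (y' - y)
    have e1 : aa / 2 = (kappa163 4 / 4 / 8) / ((m + 1 : ℕ) : ℝ) := by
      have h4 : kappa163 (3 + 1) = kappa163 4 := by norm_num
      rw [haa, h4]; field_simp; ring
    have h := min_rate_coarse m (p := kappa163 4 / 4 / 8) (q := δ / 2) (L := l1 (y' - y)) (by positivity) hL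
    rw [← e1] at h
    rw [l1_smul_sub]
    linarith
  -- the constants: `CH² · Zl 4 (aa∕2) = n⁻¹⁰·K₀²·Zl ≤ n⁻⁶·K₀²·(1 + 16∕κ′)⁴`
  have hZl := Zl_kappa_le m
  have e2 : aa / 2 = kappa163 (3 + 1) / (3 + 1) / (8 * ((m + 1 : ℕ) : ℝ)) := by rw [haa]; field_simp; ring
  have hZ0 : 0 ≤ Zl 4 (δ / 2) := Zl_nonneg (by positivity)
  have hZa0 : 0 ≤ Zl 4 (aa / 2) := Zl_nonneg (by positivity)
  set K₀ : ℝ := (MG163 (3 + 1) * periodConst (kappa163 (3 + 1)) 3) * Real.exp (kappa163 (3 + 1) / (3 + 1)) with hK₀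
  have hK₀0 : 0 ≤ K₀ := by
    have hn5 : 0 < ((((m + 1 : ℕ) : ℝ)) ^ (3 + 2))⁻¹ := by positivity
    have h := hCH0
    rw [hCH, mul_assoc] at h
    exact (mul_nonneg_iff_of_pos_left hn5).1 h
  set B : ℝ := (1 + 16 / (kappa163 (3 + 1) / (3 + 1))) ^ 4 with hB
  have eCH : 16 * CH * CH * mT j i * (Zl 4 (aa / 2) * Zl 4 (δ / 2))
      = 16 * K₀ ^ 2 * (((((m + 1 : ℕ) : ℝ)) ^ 4)⁻¹ * Zl 4 (kappa163 (3 + 1) / (3 + 1) / (8 * ((m + 1 : ℕ) : ℝ)))) * Zl 4 (δ / 2)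
        * ((((m + 1 : ℕ) : ℝ)) ^ 6)⁻¹ * mT j i := by
    rw [e2, hCH]; field_simp; ring
  have e3 : 16 * ((MG163 4 * periodConst (kappa163 4) 3) * Real.exp (kappa163 4 / 4)) ^ 2 * (1 + 16 / (kappa163 4 / 4)) ^ 4 * Zl 4 (δ / 2)
        * ((((m + 1 : ℕ) : ℝ)) ^ 6)⁻¹ * mT j i
      = 16 * K₀ ^ 2 * B * Zl 4 (δ / 2) * ((((m + 1 : ℕ) : ℝ)) ^ 6)⁻¹ * mT j i := by
    rw [hK₀, hB]; norm_num
  rw [e3]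
  have hrest : 0 ≤ Zl 4 (δ / 2) * ((((m + 1 : ℕ) : ℝ)) ^ 6)⁻¹ * mT j i := by positivity
  calc 16 * CH * CH * mT j i * (Zl 4 (aa / 2) * Zl 4 (δ / 2))
        * Real.exp (-(min (aa / 2) (δ / 2)) * l1 (((m + 1 : ℕ) : ℤ) • y' - ((m + 1 : ℕ) : ℤ) • y))
      ≤ 16 * CH * CH * mT j i * (Zl 4 (aa / 2) * Zl 4 (δ / 2)) * Real.exp (-(min (kappa163 4 / 4 / 8) (δ / 2)) * l1 (y' - y)) :=
        mul_le_mul_of_nonneg_left hexp (by positivity)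
    _ = (16 * K₀ ^ 2 * (((((m + 1 : ℕ) : ℝ)) ^ 4)⁻¹ * Zl 4 (kappa163 (3 + 1) / (3 + 1) / (8 * ((m + 1 : ℕ) : ℝ)))))
        * (Zl 4 (δ / 2) * ((((m + 1 : ℕ) : ℝ)) ^ 6)⁻¹ * mT j i) * Real.exp (-(min (kappa163 4 / 4 / 8) (δ / 2)) * l1 (y' - y)) := by
        rw [eCH]; ring
    _ ≤ (16 * K₀ ^ 2 * B) * (Zl 4 (δ / 2) * ((((m + 1 : ℕ) : ℝ)) ^ 6)⁻¹ * mT j i) * Real.exp (-(min (kappa163 4 / 4 / 8) (δ / 2)) * l1 (y' - y)) := by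
        have h1 : 16 * K₀ ^ 2 * (((((m + 1 : ℕ) : ℝ)) ^ 4)⁻¹ * Zl 4 (kappa163 (3 + 1) / (3 + 1) / (8 * ((m + 1 : ℕ) : ℝ)))) ≤ 16 * K₀ ^ 2 * B :=
          mul_le_mul_of_nonneg_left hZl (by positivity)
        exact mul_le_mul_of_nonneg_right (mul_le_mul_of_nonneg_right h1 hrest) (Real.exp_pos _).le
    _ = 16 * K₀ ^ 2 * B * Zl 4 (δ / 2) * ((((m + 1 : ℕ) : ℝ)) ^ 6)⁻¹ * mT j i * Real.exp (-(min (kappa163 4 / 4 / 8) (δ / 2)) * l1 (y' - y)) := by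
        ring

/-- [folklore] **«RK-BLK TADPOLES AT THE ROAD's PACKED TABLES»**: modulo [B5, Prop. 1.2] ∧ [B5, (1.126)–(1.127)] BY NAME there is ONE n-free triple
`kG, K ≥ 0`, `c > 0` such that for every `m` (`n = m + 1`), every PACKED pair pack `S₂` with plain block letters `mT j i·e^{−δ|u′−u|₁}` (`0 < δ`), every
first-jet family `V`, all directions `μ ν` and all sides `(i, j)`,
`Decay510 (blockWord (NlegRoad m a) V (vertex2OfK (NlegRoad m a) n S₂) (inl (i, j)) μ ν) (½·T_ij·(C_W·Zl 4 (δ∕2)·(n⁶)⁻¹·mT j i)) (min (κ′∕8) (δ∕2))` —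
the RATE `min (κ′∕8) (δ∕2)` is n-FREE, `T` the leg table of `RestKernelBlockUnit.exists_road_block_legs` (≥ one non-ff factor `≤ n⁻⁵·(…)` per genuine word,
`road_block_leg_nonff_le`), `C_W = 16·(C₄e^{κ′})²·(1 + 16∕κ′)⁴`: every genuine tadpole block word is `n⁻¹¹ × mT j i(n) ×` n-free letters (`n⁻¹⁴` for the
multiplier leg); which pack `S₂,N` and its letters are (A2-N)'s.  The (1.22) rows follow by `B12Sec2to5.secondMoment_abs_le_of_decay510`. -/
theorem exists_decay510_blockWord_inl_packed (h12 : B5.Prop12Printed (fam nOf hn1 MOf a ha)) (h126 : B5.Kernel126_127Printed (kfam nOf MOf)) :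
    ∃ kG K c : ℝ, 0 < c ∧ 0 ≤ kG ∧ 0 ≤ K ∧ ∀ (m : ℕ) (S₂ : Fin 4 → Site 4 → Fin 4 → Site 4 → MKer 4 (Fib 3))
      (V : Fin 4 → Site 4 → MKer 4 (Fib 3)) (δ : ℝ) (mT : Bool → Bool → ℝ) (μ ν : Fin 4), 0 < δ →
      (∀ κ u κ' u' j i, Summable fun p : Site 4 × Site 4 => ∑ g, ∑ f, |blk (S₂ κ u κ' u') j i p.1 p.2 g f|) →
      (∀ κ u κ' u' j i, ∑' p : Site 4 × Site 4, ∑ g, ∑ f, |blk (S₂ κ u κ' u') j i p.1 p.2 g f| ≤ mT j i * Real.exp (-δ * l1 (u' - u))) →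
      ∀ i j : Bool, Decay510 (blockWord (NlegRoad m a) V (vertex2OfK (NlegRoad m a) (m + 1) S₂) (Sum.inl (i, j)) μ ν)
        ((1 / 2) * ((bif (i && j) then kG / 2 + K / 2 / (((m + 1 : ℕ) : ℝ)) ^ 2
            else bif (i || j) then ((((m + 1 : ℕ) : ℝ)) ^ 5)⁻¹ * (MG163 4 * periodConst (kappa163 4) 3) * Real.exp (kappa163 4 / 4)
            else 2 * ((((m + 1 : ℕ) : ℝ)) ^ 8)⁻¹ * c166Z 3)
          * (16 * ((MG163 4 * periodConst (kappa163 4) 3) * Real.exp (kappa163 4 / 4)) ^ 2 * (1 + 16 / (kappa163 4 / 4)) ^ 4 * Zl 4 (δ / 2)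
              * ((((m + 1 : ℕ) : ℝ)) ^ 6)⁻¹ * mT j i)))
        (min (kappa163 4 / 4 / 8) (δ / 2)) := by
  obtain ⟨kG, K, c, hc, hkG, hK, hlegs⟩ := exists_road_block_legs ha h12 h126
  refine ⟨kG, K, c, hc, hkG, hK, fun m S₂ V δ mT μ ν hδ hTs hTm i j => ?_⟩
  have hn0 : (0 : ℝ) < ((m + 1 : ℕ) : ℝ) := by exact_mod_cast Nat.succ_pos m
  have hσ0 : 0 ≤ c / ((m + 1 : ℕ) : ℝ) := by positivity
  have hT0 : ∀ i j, 0 ≤ (bif (i && j) then kG / 2 + K / 2 / (((m + 1 : ℕ) : ℝ)) ^ 2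
      else bif (i || j) then ((((m + 1 : ℕ) : ℝ)) ^ 5)⁻¹ * (MG163 4 * periodConst (kappa163 4) 3) * Real.exp (kappa163 4 / 4)
      else 2 * ((((m + 1 : ℕ) : ℝ)) ^ 8)⁻¹ * c166Z 3) := fun i j => (hlegs m i j).nonneg 0
  have hW := fun z j' i' => mass_blk_vertex2OfK_NlegRoad_le m ha h12 h126 hδ hTs hTm μ 0 ν z j' i'
  refine decay510_blockWord_inl_of_decays (K := NlegRoad m a) (V := V) (W := vertex2OfK (NlegRoad m a) (m + 1) S₂)
    (mW := fun j i => 16 * ((MG163 4 * periodConst (kappa163 4) 3) * Real.exp (kappa163 4 / 4)) ^ 2 * (1 + 16 / (kappa163 4 / 4)) ^ 4 * Zl 4 (δ / 2)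
      * ((((m + 1 : ℕ) : ℝ)) ^ 6)⁻¹ * mT j i)
    (fun i j => hlegs m i j) hσ0 hT0 μ ν (fun z j' i' => (hW z j' i').1) (fun z j' i' => ?_) i j
  have h := (hW z j' i').2
  rwa [sub_zero] at h

end Road

end Summit.QuantumFields.BalabanUV.Beta.D1BFx.RestTableBlockMass

end
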